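import Summits.HodgeConjecture.HodgeConjecture.Theorems.HCCMUnconditionalHLiu418OfTwoFacts
import Summits.HodgeConjecture.CorCM.HypLiu418.A3Liu418FaltingsIsotypicOfCMType
import Summits.HodgeConjecture.CorCM.HypLiu418.A3Liu418T5pAlbaneseCMType
import HarnessLib

/-!
# `HCCMUnconditional.HLiu418` WITHOUT the [Fal83] binder: hLiu418 ⇐ {III-9′ `h415`} + items `H21`, `H413` (floor «Fal OUT», T5′ by name)

Topic: summit `HodgeConjecture`, sub-problem `HodgeConjecture`, route `HCCMUnconditional`, crux `HLiu418` (stmt-HodgeConjecture-24832).  PROVER FILE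
(cell hodgecm-mathlib, D-0175 plan (A2) «FLOOR v6 — Fal OUT», prover 2 = A-p01 (g8), strategy «direct isotypic glue»; A-plan1 (g12) 18:02:11Z),
THEOREMS ONLY, namespace `Summit.HodgeConjecture.CorCM.HypLiu418`, DEFAULT heartbeats.

★ `HLiu418_of_facts_of_lemma24Proj` / `HLiu418_of_two_facts` (`HCCMUnconditionalHLiu418OfTwoFacts.lean`) close the crux `HLiu418` modulo the row VI-1
binder `hFal : ∀ K A B ℓ, faltings_tate_bijective A B ℓ` ([Faltings1983] Satz 4) and row III-9′ `h415 : Thm415AtFace` ([Liu2021] Thm. 4.15 at the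
face = [MurtyRamakrishnan1992] Prop. 6), plus the items `H21`, `H413`.  The binder `hFal` is consumed ONLY through the Faltings–isotypic slot
`StubFaltingsIsotypic` (`faltingsIsotypic_of_faltings hFal`).  LINE T5′ (director s155/s157/s158; A-plan1 (g11/g12), road owner A-p09) DERIVES that
slot from the item `H413`: the Albanese of the GS unitary Shimura curve is of CM type from `H413`'s three printed sentences (multiplicity-one lever; ★
F3b `A3Liu418T5pAlbaneseCMType :: hF_of_h413`, over ★ F1/F2/F3a and the generic leaves A″/B/C/D), and for abelian varieties of CM type the Tate map is
bijective WITHOUT Faltings (★ (J2) `A3Liu418FaltingsIsotypicOfCMType :: stubFaltingsIsotypic_of_hF`).  This file is the DIRECT GLUE: the closing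
composition of `HLiu418_of_facts_of_lemma24Proj` character for character, with `faltingsIsotypic_of_faltings hFal` replaced by
`stubFaltingsIsotypic_of_hF (hF_of_h413 h413)`.

* `HLiu418_of_h415_of_lemma24Proj (hLp) (h415) (hε) (h21) (h413) (hD3) : HCCMUnconditional.HLiu418` — modulo (Lp), rows III-9′ / III-11 and the items;
* **`HLiu418_of_h415 (h415) (h21) (h413) : HCCMUnconditional.HLiu418`** — (Lp) = ★ `albanese_bettiOne_pullback_bijective_of_isProjectiveOver`,
  III-11 = ★ `epsRigidAtFace_holds`, HD3 = ★ `Theorems.HD3_proof`.  `--axioms` = {propext, Classical.choice, Quot.sound}: row VI-1 [Fal83] has LEFT the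
  hLiu418 cone.  Consumer: the floor editions «Fal OUT» (generic v6 / print-exact v11: the hLiu418 slot becomes `HLiu418_of_h415 h415 h21 h413` where v1–v5 /
  v10 read `HLiu418_of_two_facts hFal h415 h21 h413`).

HC_CM is proved only modulo the 7 printed citations until rung 0 closes; this file discharges no binder by itself (it removes [Fal83] from hLiu418's
residual list, which becomes {III-9′} + items H21/H413, i.e. print-level {[Liu21] Thm. 4.15 / [MR92] Prop. 6} + the H413 trio + [Shimura1998] Thm. 21.4).

## References
* [Liu2021] Y. Liu, arXiv:2102.11518 = Camb. J. Math. 9 (2021): Thm. 4.18 (proof, FJcycle.tex l. 2235–2290), Lem. 2.4 (1), Prop. 4.13, Thm. 4.15.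
* [MurtyRamakrishnan1992] Prop. 6; [Grothendieck1962FGA6] Thm. 3.3 (iii) (Albanese / Picard, for (Lp)).
-/

set_option autoImplicit false

noncomputable section

namespace Summit.HodgeConjecture.CorCM.HypLiu418

open scoped TensorProduct Matrix
open NumberField NumberField.InfinitePlace
open HodgeCM.Model HodgeCM.Model.LiuIndex HodgeCM.Model.TowerCarrier
open Summit.HodgeConjecture.CorCM.Model
open Literature.AlgebraicGeometry.Motives (CMType AbelianVariety)
open Literature.AlgebraicGeometry.HodgeTheory Literature.NumberTheory.Automorphic.PicardCM
open Literature.AlgebraicGeometry.ShimuraVarieties.UnitaryCanonicalModel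
open Literature.NumberTheory.ComplexMultiplication
open Literature.NumberTheory.Automorphic
open Literature.NumberTheory.Automorphic.Liu2021 Literature.NumberTheory.Automorphic.Liu2021.AppendixC
open Literature.NumberTheory.Automorphic.Liu2021.AppendixC.RestOne
open Literature.RepresentationTheory Literature.RepresentationTheory.Liu2021
open Summit.HodgeConjecture.CorCM.Transposition
open Summit.HodgeConjecture.CorCM.D2Bridge.MuKeyIdentLemD3DelRecConjOmegaEndT.PrintedCitationHypotheses (HypLiu418 Hyp411 Hyp413 HypD3 HypD1pp)
open Summit.HodgeConjecture.CorCM.Lines.A3Liu418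
open Summit.HodgeConjecture.HodgeConjecture.Theses (HCCMUnconditional.HLiu418 HCCMUnconditional.H21 HCCMUnconditional.H413 HCCMUnconditional.HD3
  HCCMUnconditional.HDel)

open CategoryTheory CategoryTheory.Limits AlgebraicGeometry MonoidalCategory CartesianMonoidalCategory
open Literature.AlgebraicGeometry.Motives
open AbelianVariety (bcFunctor)

/-- **CLOSING HEAD of item stmt-HodgeConjecture-24832 from (Lp) WITHOUT the [Fal83] binder** — `HLiu418_of_facts_of_lemma24Proj` with its row VI-1 binder
`hFal : ∀ K A B ℓ, faltings_tate_bijective A B ℓ` REPLACED by the T5′ derivation from the item `H413`: the Faltings–isotypic slot `StubFaltingsIsotypic` is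
`stubFaltingsIsotypic_of_hF (hF_of_h413 h413)` (★ (J2) `A3Liu418FaltingsIsotypicOfCMType`, ★ F3b `A3Liu418T5pAlbaneseCMType`: the Albanese of the GS curve is of
CM type from `H413`'s three printed sentences, and for CM abelian varieties the Tate map is bijective by Shimura–Taniyama / Pohlmann / Deligne (Milne) —
no Faltings).  Composition character for character that of `HLiu418_of_facts_of_lemma24Proj` otherwise: modulo (Lp), hLiu418 ⇐ {III-9′ `h415`, III-11 `hε`} +
the items `H21`, `H413`, `HD3`.  HC_CM is proved only modulo the 7 printed citations until rung 0 closes.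
[cite: Liu2021, Thm. 4.18 (FJcycle.tex l. 2235–2290); Lem. 2.4 (1); Thm. 4.15] -/
theorem HLiu418_of_h415_of_lemma24Proj
    (hLp : ∀ {k : Type} [Field k] [CharZero k] [Algebra k ℂ] {d : ℕ} (X : SchemeOver k) [SmoothOfRelativeDimension d X.hom],
      IsProjectiveOver X → ∀ (a : Albanese X) (Ξ : Type) (Y : Ξ → SchemeOver ℂ) [∀ q, GeometricallyIrreducible (Y q).hom]
        (inj : ∀ q, Y q ⟶ (bcFunctor k ℂ).obj X) (_ : IsColimit (Cofan.mk ((bcFunctor k ℂ).obj X) inj))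
        {d' : ℕ} (_ : ∀ q, IsSmoothProjective d' (Y q))
        (_ : ∀ (q : Ξ) (𝒥 : Jacobian (Y q)), Module.finrank ℚ (bettiCohomology (Y q) 1) ≤ 2 * 𝒥.J.dim)
        (x : ∀ q, AlgPoints (Y q) ℂ) (ℓ : ∀ q, Y q ⊗ Y q ⟶ (bcFunctor k ℂ).obj a.nabla.N)
        (_ : ∀ q, ℓ q ≫ (bcFunctor k ℂ).map a.nabla.incl = (inj q ⊗ₘ inj q) ≫ Functor.LaxMonoidal.μ (bcFunctor k ℂ) X X)
        (αx : (bcFunctor k ℂ).obj X ⟶ (a.Alb.baseChange ℂ).X)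
        (_ : ∀ q, inj q ≫ αx = lift (𝟙 (Y q)) (toSpecOver (Y q) ≫ x q) ≫ ℓ q ≫ (bcFunctor k ℂ).map a.α),
        Function.Bijective (BettiUniverse.pull αx 1))
    (h415 : Thm415AtFace) (hε : EpsRigidAtFace)
    (h21 : Summit.HodgeConjecture.HodgeConjecture.Theses.HCCMUnconditional.H21) (h413 : Summit.HodgeConjecture.HodgeConjecture.Theses.HCCMUnconditional.H413)
    (hD3 : Summit.HodgeConjecture.HodgeConjecture.Theses.HCCMUnconditional.HD3) :
    Summit.HodgeConjecture.HodgeConjecture.Theses.HCCMUnconditional.HLiu418 := by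
  intro hDel F _ h6 ι₁ V a Φ hΦ ν hν hw R' hR' Φ'
  have hP : StubBettiThetaModel := bettiThetaModel_of_lemma24Proj hLp h413
  have s2 : StubNonIso := nonIso_of_hD3 hD3
  have hFI : StubFaltingsIsotypic := stubFaltingsIsotypic_of_hF (hF_of_h413 h413)
  exact thm418AsPrinted_of_items _
    (mainGalois_of_facts (etaleBettiModel_of_facts hP) hFI (galoisLabelSeparation_of_h21_of_thm415 h21 h415)
      (mainGaloisGlue_of_h21_of_epsRigid h21 hε) h415 Summit.HodgeConjecture.HodgeConjecture.Theorems.H411_proof s2 hDel F h6 V a Φ hΦ ν hν hw Φ' ⟨R', hR'⟩)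
    (levelInvariants_holds hDel F h6 V a Φ hΦ ν hν hw Φ') (s2 hDel F h6 V a Φ hΦ ν hν hw Φ')

/-- **`HCCMUnconditional.HLiu418` ⇐ {III-9′ `h415`} + items `H21`, `H413` — NO Faltings binder.**  `HLiu418_of_h415_of_lemma24Proj` fed with the CLOSED tree
terms: (Lp) = ★ `albanese_bettiOne_pullback_bijective_of_isProjectiveOver` ([Liu2021] Lem. 2.4 (1), (G)-road), III-11 = ★ `epsRigidAtFace_holds`, HD3 = ★
`Theorems.HD3_proof`.  The VI-1 row [Fal83] has LEFT the hLiu418 cone: it is derived from `H413` (T5′).  This is the hLiu418 term of the floor editions v6 / v11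
(«Fal OUT»: floor inputs 6 → 5 generic, 5 → 4 with (F′)).  HC_CM is proved only modulo the 7 printed citations until rung 0 closes.
[cite: Liu2021, Thm. 4.18; Lem. 2.4 (1); Thm. 4.15] [cite: Grothendieck1962FGA6, Thm. 3.3 (iii)] -/
theorem HLiu418_of_h415 (h415 : Thm415AtFace)
    (h21 : Summit.HodgeConjecture.HodgeConjecture.Theses.HCCMUnconditional.H21) (h413 : Summit.HodgeConjecture.HodgeConjecture.Theses.HCCMUnconditional.H413) :
    Summit.HodgeConjecture.HodgeConjecture.Theses.HCCMUnconditional.HLiu418 :=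
  HLiu418_of_h415_of_lemma24Proj albanese_bettiOne_pullback_bijective_of_isProjectiveOver h415 epsRigidAtFace_holds h21 h413
    Summit.HodgeConjecture.HodgeConjecture.Theorems.HD3_proof

end Summit.HodgeConjecture.CorCM.HypLiu418

end
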